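import Literature.Probability.Percolation.TwoClusterExchange
import HarnessLib

/-!
# Lonely-cluster exchange: BHK 2006 Thm. 1.5 for cluster-cardinality events, and the
# two-observer transfer ("the lonelier terminal serves the glued observer")

Topic `Literature/Probability/Percolation`.  Bond percolation `μ = prodBernoulli w` with arbitrary edge
probabilities on a finite vertex type `V`, a finite set `A` of distinguished vertices ("relays"/terminals),
a level `j : ℕ`.  For a vertex `v` write `π(v) = {a ∈ A : v ↔ a}` (the Finset
`A.filter (fun z => ω ∈ openConn v z)`; `v ∈ π(v)` when `v ∈ A`) and call `v` LONELY when `|π(v)| ≤ j`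
(event `R_v`).

Van den Berg–Häggström–Kahn's Theorem 1.5 ([VandenbergHaggstromKahn2005, Thm. 1.5 p. 7]; tree:
`twoClusterExchange`, event form) says that on `D = {s ↮ t}` the indicators `1{e ∈ C_s}` and `1{e ∉ C_t}`
are positively associated.  Cardinality events are monotone in the clusters — `{|π(t)| ≤ j}` is closed
under shrinking `C_t` (type `(+)` for the pair `(s,t)`), `{|π(s)| ≤ j}` under shrinking `C_s` (type `(−)`),
`{t ↔ x}` under enlarging `C_t` (type `(−)`) — so Theorem 1.5 yields the

* **lonely-cluster exchange** (`lonelyClusterExchange`): for `s ≠ t` and any vertex `x`,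
  `μ(D ∩ R_t ∩ {t ↔ x}) · μ(D ∩ R_s) ≤ μ(D ∩ R_t) · μ(D ∩ R_s ∩ {t ↔ x})`
  ("given `s ↮ t`, joining `x` is less likely for a lonely `t` than for `t` when `s` is lonely");
* its linearisation under `μ(R_s) ≤ μ(R_t)` (`lonelyClusterTransfer`):
  `μ(D ∩ R_t ∩ {t ↔ x}) ≤ μ(D ∩ R_s ∩ {t ↔ x}) + (μ(R_t) − μ(R_s))`, using `R_t ∩ {s ↔ t} = R_s ∩ {s ↔ t}`;
* and, by bookkeeping alone, the **two-observer transfer** (`twoObserver_le_of_lonelier`): for vertices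
  `x, y, c` with `μ(R_y) ≤ μ(R_c)`,
  `μ(c ↮ x, c ↮ y, 1 ≤ |π(x) ∪ π(y)| ≤ j) ≤ μ(c ↮ x, c ↮ y, |π(c)| ≤ j)`.
  (Proof: the left event lies in `R_y ∩ {y ↮ c} ∩ {c ↮ x}` because `π(y) ⊆ π(x) ∪ π(y)`; split `R_c` and `R_y`
  along `{y ↔ c}` and `{c ↔ x}` and apply the transfer with `s = y`, `t = c`.)

* the observer-SET forms (`lonelyClusterExchange_typeMinus`, `lonelyClusterTransfer_typeMinus` for an
  arbitrary event `B` closed under (shrinking `C_s`, enlarging `C_t`), and `observerSet_le_of_lonelier`: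
  `μ(c ↮ O, 1 ≤ |π(O)| ≤ j) ≤ μ(c ↮ O, |π(c)| ≤ j)` for any finite `O ∋ y` with `μ(R_y) ≤ μ(R_c)`).

* the **mirror-odds exchange** (`mirrorOdds_exchange`; instance `mirrorOdds_lightCluster_marker`): for
  "worlds" `W₊` of type `(+)` and `W₋` of type `(−)` and marker events `E_s` of type `(+)`, `E_t` of type `(−)`
  that are incompatible on `D`,
  `μ(D ∩ W₊ ∩ E_t) · μ(D ∩ W₋ ∩ E_s) ≤ μ(D ∩ W₋ ∩ E_sᶜ) · μ(D ∩ W₊ ∩ E_tᶜ)`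
  ("the odds that the marker joins `t` in a world of type `(+)`, times the odds that it joins `s` in a world
  of type `(−)`, is at most `1`").  Proof: one application of Theorem 1.5 per world (opposite types are
  negatively correlated given `D`, so `odds(E_t | D ∩ W₊) ≤ odds(E_t | D)` and `odds(E_s | D ∩ W₋) ≤ odds(E_s | D)`)
  and `odds(E_t | D) · odds(E_s | D) ≤ 1` by incompatibility.  The instance `W₊ = R_t ∩ R_sᶜ` ("`t` lonely, `s`
  not"), `W₋ = R_s ∩ R_tᶜ`, `E_s = {s ↔ b}`, `E_t = {t ↔ b}` reads
  `μ(D, t lonely, s not, t ↔ b) · μ(D, s lonely, t not, s ↔ b) ≤ μ(D, s lonely, t not, s ↮ b) · μ(D, t lonely, s not, t ↮ b)`.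
  This is the UNGUARDED form of the exchange called (SP) (prover `prim-hp-7`, memo HP7-GX-FAMILY §2b) and
  (LSL-X) (prover `prim-hp-1`, `Summit…Theorems.HullPort.lsl_pair_of_exchange`) on the hull-port line of
  `stmt-CriticalPhenomena-4575`, where all four factors are in addition intersected with the two-sided guard
  `{z ∉ C_s ∪ C_t}` for a further vertex `z`.  The guarded form is NOT in print and is not a corollary of
  Theorem 1.5: the guard is of mixed type, positive association given `D ∩ {z ∉ C_s ∪ C_t}` fails, and both
  "middle-term" halves `odds(E_t | D_z ∩ W₊) ≤ odds(E_t | D_z)`, `odds(E_s | D_z) ≥ odds(E_s | D_z ∩ W₋)` have exact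
  counterexamples (cell census, not literature); the printed derivations of this family — [VandenbergHaggstromKahn2005,
  Remark 2, pp. 5–6 (Thm. 1.1 from Thm. 1.2 via four correlation inequalities under the common conditioning `R_{X∩Y}`)]
  and [ibid., pp. 7–8 (Thm. 1.5 from Thm. 1.3 by disintegration over `C_s = W`, Harris in `G ∖ W̄`, monotonicity
  in `W`)] — both pass through such a middle term.

The two-observer statement is the case "`y` no lonelier than `c`" of the champion-stability inequality CS₂ of the
`NoHeavyLowerTail` line of `stmt-CriticalPhenomena-4575` (there: `x ∉ A` an observer, `c` a maximiser of
`μ(R_·)` over `A`, `y` arbitrary); in particular it holds whenever `y ∈ A`, for every weighted graph, every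
`A` and every `j`.  No definition and no named fact is introduced.

## References

* J. van den Berg, O. Häggström, J. Kahn, *Some conditional correlation inequalities for percolation and
  related processes*, Random Structures Algorithms 29 (2006) 417–435, Thm. 1.5 (p. 7). [VandenbergHaggstromKahn2005]
-/

noncomputable section

open MeasureTheory Set
open Literature.Probability.LatticeModels (prodBernoulli)
open scoped Classical

namespace Literature.Probability.Percolation

variable {V : Type*}

namespace LonelyClusterExchange

/-- The loneliness event of `t`, `{|π(t)| ≤ j}`, is of type `(+)` for the pair `(s, t)`: closed under
enlarging `C_s` and shrinking `C_t`. [folklore] -/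
theorem typePlus_card_le (A : Finset V) (j : ℕ) (s t : V) ⦃ω ω' : BondConfig V⦄
    (hs : openEdgeCluster ω s ⊆ openEdgeCluster ω' s) (ht : openEdgeCluster ω' t ⊆ openEdgeCluster ω t)
    (h : ω ∈ {ω : BondConfig V | (A.filter fun z => ω ∈ openConn t z).card ≤ j}) :
    ω' ∈ {ω : BondConfig V | (A.filter fun z => ω ∈ openConn t z).card ≤ j} := by
  simp only [mem_setOf_eq] at h ⊢
  refine le_trans (Finset.card_le_card ?_) h
  intro z hz
  rw [Finset.mem_filter] at hz ⊢
  exact ⟨hz.1, typeMinus_openConn s t z hs ht hz.2⟩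

/-- The loneliness event of `s`, `{|π(s)| ≤ j}`, is of type `(−)` for the pair `(s, t)`: closed under
shrinking `C_s` and enlarging `C_t`. [folklore] -/
theorem typeMinus_card_le (A : Finset V) (j : ℕ) (s t : V) ⦃ω ω' : BondConfig V⦄
    (hs : openEdgeCluster ω' s ⊆ openEdgeCluster ω s) (ht : openEdgeCluster ω t ⊆ openEdgeCluster ω' t)
    (h : ω ∈ {ω : BondConfig V | (A.filter fun z => ω ∈ openConn s z).card ≤ j}) :
    ω' ∈ {ω : BondConfig V | (A.filter fun z => ω ∈ openConn s z).card ≤ j} := by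
  simp only [mem_setOf_eq] at h ⊢
  refine le_trans (Finset.card_le_card ?_) h
  intro z hz
  rw [Finset.mem_filter] at hz ⊢
  exact ⟨hz.1, typePlus_openConn s t z hs ht hz.2⟩

end LonelyClusterExchange

open LonelyClusterExchange

/-- **Lonely-cluster exchange** (BHK 2006 Thm. 1.5 with cardinality events).  For `s ≠ t`, any vertex
`x`, any finite `A` and level `j`, with `D = {s ↮ t}`, `R_v = {|π(v)| ≤ j}`:
`μ(D ∩ (R_t ∩ {t ↔ x})) · μ(D ∩ R_s) ≤ μ(D ∩ R_t) · μ(D ∩ ({t ↔ x} ∩ R_s))`.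
[cite: VandenbergHaggstromKahn2005, Thm. 1.5 (p. 7) — corollary, derived in this file] -/
theorem lonelyClusterExchange [Fintype V] (w : Sym2 V → unitInterval) {s t : V} (hst : s ≠ t)
    (x : V) (A : Finset V) (j : ℕ) :
    (prodBernoulli w).real ((openConn s t)ᶜ ∩
        ({ω : BondConfig V | (A.filter fun z => ω ∈ openConn t z).card ≤ j} ∩ openConn t x)) *
      (prodBernoulli w).real ((openConn s t)ᶜ ∩
        {ω : BondConfig V | (A.filter fun z => ω ∈ openConn s z).card ≤ j}) ≤
    (prodBernoulli w).real ((openConn s t)ᶜ ∩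
        {ω : BondConfig V | (A.filter fun z => ω ∈ openConn t z).card ≤ j}) *
      (prodBernoulli w).real ((openConn s t)ᶜ ∩
        (openConn t x ∩ {ω : BondConfig V | (A.filter fun z => ω ∈ openConn s z).card ≤ j})) := by
  have key := twoClusterExchange w hst
    (A₁ := {ω : BondConfig V | (A.filter fun z => ω ∈ openConn t z).card ≤ j})
    (A₂ := (univ : Set (BondConfig V))) (B₁ := openConn t x)
    (B₂ := {ω : BondConfig V | (A.filter fun z => ω ∈ openConn s z).card ≤ j})
    (typePlus_card_le A j s t) (fun _ _ _ _ _ => mem_univ _) (typeMinus_openConn s t x)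
    (typeMinus_card_le A j s t)
  simpa only [univ_inter, inter_univ] using key

/-- **Lonely-cluster transfer** (linearised exchange).  If `s ≠ t` and `μ(R_s) ≤ μ(R_t)`, then for any
vertex `x`:  `μ(D ∩ R_t ∩ {t ↔ x}) ≤ μ(D ∩ {t ↔ x} ∩ R_s) + (μ(R_t) − μ(R_s))`, `D = {s ↮ t}`.
(From `lonelyClusterExchange` and `R_t ∩ {s ↔ t} = R_s ∩ {s ↔ t}`.)
[cite: VandenbergHaggstromKahn2005, Thm. 1.5 (p. 7) — corollary, derived in this file] -/
theorem lonelyClusterTransfer [Fintype V] (w : Sym2 V → unitInterval) {s t : V} (hst : s ≠ t)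
    (x : V) (A : Finset V) (j : ℕ)
    (hle : (prodBernoulli w).real {ω : BondConfig V | (A.filter fun z => ω ∈ openConn s z).card ≤ j} ≤
      (prodBernoulli w).real {ω : BondConfig V | (A.filter fun z => ω ∈ openConn t z).card ≤ j}) :
    (prodBernoulli w).real ((openConn s t)ᶜ ∩
        ({ω : BondConfig V | (A.filter fun z => ω ∈ openConn t z).card ≤ j} ∩ openConn t x)) ≤
      (prodBernoulli w).real ((openConn s t)ᶜ ∩
        (openConn t x ∩ {ω : BondConfig V | (A.filter fun z => ω ∈ openConn s z).card ≤ j})) +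
      ((prodBernoulli w).real {ω : BondConfig V | (A.filter fun z => ω ∈ openConn t z).card ≤ j} -
        (prodBernoulli w).real {ω : BondConfig V | (A.filter fun z => ω ∈ openConn s z).card ≤ j}) := by
  set μ := prodBernoulli w with hμ
  set Rt : Set (BondConfig V) := {ω | (A.filter fun z => ω ∈ openConn t z).card ≤ j} with hRt
  set Rs : Set (BondConfig V) := {ω | (A.filter fun z => ω ∈ openConn s z).card ≤ j} with hRs
  set D : Set (BondConfig V) := (openConn s t)ᶜ with hD
  set X : Set (BondConfig V) := openConn t x with hX
  have hmeas : ∀ S : Set (BondConfig V), MeasurableSet S := fun S => (Set.toFinite S).measurableSet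
  have key : μ.real (D ∩ (Rt ∩ X)) * μ.real (D ∩ Rs) ≤ μ.real (D ∩ Rt) * μ.real (D ∩ (X ∩ Rs)) :=
    lonelyClusterExchange w hst x A j
  -- on `{s ↔ t}` the two loneliness events coincide
  have hF2 : Rt \ D = Rs \ D := by
    ext ω
    simp only [hRt, hRs, hD, mem_sdiff, mem_compl_iff, not_not, mem_setOf_eq]
    constructor
    · rintro ⟨h, hst'⟩
      have hst'' : (openGraph ω).Reachable s t := hst'
      have heq : (A.filter fun z => ω ∈ openConn s z) = (A.filter fun z => ω ∈ openConn t z) :=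
        Finset.filter_congr fun z _ =>
          ⟨fun hz => (hst''.symm.trans hz : (openGraph ω).Reachable t z),
            fun hz => (hst''.trans hz : (openGraph ω).Reachable s z)⟩
      rw [heq]
      exact ⟨h, hst'⟩
    · rintro ⟨h, hst'⟩
      have hst'' : (openGraph ω).Reachable s t := hst'
      have heq : (A.filter fun z => ω ∈ openConn t z) = (A.filter fun z => ω ∈ openConn s z) :=
        Finset.filter_congr fun z _ =>
          ⟨fun hz => (hst''.trans hz : (openGraph ω).Reachable s z),
            fun hz => (hst''.symm.trans hz : (openGraph ω).Reachable t z)⟩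
      rw [heq]
      exact ⟨h, hst'⟩
  have hsplit_t : μ.real (Rt ∩ D) + μ.real (Rt \ D) = μ.real Rt := measureReal_inter_add_sdiff (hmeas D)
  have hsplit_s : μ.real (Rs ∩ D) + μ.real (Rs \ D) = μ.real Rs := measureReal_inter_add_sdiff (hmeas D)
  have h3 : μ.real (D ∩ Rt) = μ.real Rt - μ.real (Rt \ D) := by rw [inter_comm]; linarith
  have h2 : μ.real (D ∩ Rs) = μ.real Rs - μ.real (Rs \ D) := by rw [inter_comm]; linarith
  have h32 : μ.real (D ∩ Rt) - μ.real (D ∩ Rs) = μ.real Rt - μ.real Rs := by rw [h3, h2, hF2]; ring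
  have hm4 : μ.real (D ∩ (X ∩ Rs)) ≤ μ.real (D ∩ Rs) :=
    measureReal_mono (inter_subset_inter_right _ inter_subset_right)
  have hm1 : μ.real (D ∩ (Rt ∩ X)) ≤ μ.real (D ∩ Rt) :=
    measureReal_mono (inter_subset_inter_right _ inter_subset_left)
  have hΔ : 0 ≤ μ.real Rt - μ.real Rs := by linarith
  by_cases h0 : μ.real (D ∩ Rs) = 0
  · have hm4' : μ.real (D ∩ (X ∩ Rs)) = 0 := le_antisymm (h0 ▸ hm4) measureReal_nonneg
    rw [hm4']
    linarith
  · have hpos : 0 < μ.real (D ∩ Rs) := lt_of_le_of_ne measureReal_nonneg (Ne.symm h0)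
    -- `m₁ m₂ ≤ m₃ m₄ = (m₂ + Δ) m₄ ≤ m₂ (m₄ + Δ)`
    have h' : μ.real (D ∩ (Rt ∩ X)) * μ.real (D ∩ Rs) ≤
        μ.real (D ∩ Rs) * (μ.real (D ∩ (X ∩ Rs)) + (μ.real Rt - μ.real Rs)) := by
      have h3' : μ.real (D ∩ Rt) = μ.real (D ∩ Rs) + (μ.real Rt - μ.real Rs) := by linarith
      rw [h3'] at key
      nlinarith [measureReal_nonneg (μ := μ) (s := D ∩ (X ∩ Rs))]
    rw [mul_comm] at h'
    exact le_of_mul_le_mul_left h' hpos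

/-- **Two-observer transfer ("the lonelier terminal serves the glued observer").**  For vertices
`x, y, c`, a finite `A` and a level `j` with `μ(R_y) ≤ μ(R_c)` (`R_v = {|π(v)| ≤ j}`):
`μ(c ↮ x, c ↮ y, 1 ≤ |π(x) ∪ π(y)| ≤ j) ≤ μ(c ↮ x, c ↮ y, |π(c)| ≤ j)`,
where `π(x) ∪ π(y)` is the Finset `A.filter (fun z => x ↔ z ∨ y ↔ z)`.  This is the champion-stability
inequality CS₂ of the `NoHeavyLowerTail` line for every `y` that is no lonelier than `c` — in particular for
every relay `y ∈ A` when `c` maximises `μ(R_·)` over `A` — on every finite weighted graph, for all `A`, `j`.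
[cite: VandenbergHaggstromKahn2005, Thm. 1.5 (p. 7) — corollary, derived in this file] -/
theorem twoObserver_le_of_lonelier [Fintype V] (w : Sym2 V → unitInterval) (A : Finset V)
    (x y c : V) (j : ℕ)
    (hle : (prodBernoulli w).real {ω : BondConfig V | (A.filter fun z => ω ∈ openConn y z).card ≤ j} ≤
      (prodBernoulli w).real {ω : BondConfig V | (A.filter fun z => ω ∈ openConn c z).card ≤ j}) :
    (prodBernoulli w).real {ω : BondConfig V | ω ∉ openConn c x ∧ ω ∉ openConn c y ∧
        1 ≤ (A.filter fun z => ω ∈ openConn x z ∨ ω ∈ openConn y z).card ∧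
        (A.filter fun z => ω ∈ openConn x z ∨ ω ∈ openConn y z).card ≤ j} ≤
      (prodBernoulli w).real {ω : BondConfig V | ω ∉ openConn c x ∧ ω ∉ openConn c y ∧
        (A.filter fun z => ω ∈ openConn c z).card ≤ j} := by
  set μ := prodBernoulli w with hμ
  set Rc : Set (BondConfig V) := {ω | (A.filter fun z => ω ∈ openConn c z).card ≤ j} with hRc
  set Ry : Set (BondConfig V) := {ω | (A.filter fun z => ω ∈ openConn y z).card ≤ j} with hRy
  set D : Set (BondConfig V) := (openConn y c)ᶜ with hD
  set X : Set (BondConfig V) := openConn c x with hX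
  have hmeas : ∀ S : Set (BondConfig V), MeasurableSet S := fun S => (Set.toFinite S).measurableSet
  by_cases hyc : y = c
  · subst hyc
    have hempty : {ω : BondConfig V | ω ∉ openConn y x ∧ ω ∉ openConn y y ∧
        1 ≤ (A.filter fun z => ω ∈ openConn x z ∨ ω ∈ openConn y z).card ∧
        (A.filter fun z => ω ∈ openConn x z ∨ ω ∈ openConn y z).card ≤ j} = ∅ := by
      ext ω
      simp only [mem_setOf_eq, mem_empty_iff_false, iff_false, not_and]
      intro _ h
      exact absurd (SimpleGraph.Reachable.refl y : (openGraph ω).Reachable y y) h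
    rw [hempty, measureReal_empty]
    exact measureReal_nonneg
  -- the right-hand event is `Rc ∩ D ∩ Xᶜ`, the left-hand event lies in `Ry ∩ D ∩ Xᶜ`
  have hsymm : (openConn y c : Set (BondConfig V)) = openConn c y :=
    Set.ext fun _ => ⟨SimpleGraph.Reachable.symm, SimpleGraph.Reachable.symm⟩
  have hR : {ω : BondConfig V | ω ∉ openConn c x ∧ ω ∉ openConn c y ∧
      (A.filter fun z => ω ∈ openConn c z).card ≤ j} = (Rc ∩ D) \ X := by
    ext ω
    simp only [hRc, hD, hX, mem_sdiff, mem_inter_iff, mem_compl_iff, mem_setOf_eq,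
      hsymm]
    tauto
  have hL : {ω : BondConfig V | ω ∉ openConn c x ∧ ω ∉ openConn c y ∧
      1 ≤ (A.filter fun z => ω ∈ openConn x z ∨ ω ∈ openConn y z).card ∧
      (A.filter fun z => ω ∈ openConn x z ∨ ω ∈ openConn y z).card ≤ j} ⊆ (Ry ∩ D) \ X := by
    intro ω hω
    obtain ⟨hcx, hcy, -, hU⟩ := hω
    simp only [hRy, hD, hX, mem_sdiff, mem_inter_iff, mem_compl_iff, mem_setOf_eq, hsymm]
    refine ⟨⟨le_trans (Finset.card_le_card ?_) hU, hcy⟩, hcx⟩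
    intro z hz
    rw [Finset.mem_filter] at hz ⊢
    exact ⟨hz.1, Or.inr hz.2⟩
  rw [hR]
  refine le_trans (measureReal_mono hL) ?_
  -- transfer with `s = y`, `t = c`
  have hT : μ.real (D ∩ (Rc ∩ X)) ≤ μ.real (D ∩ (X ∩ Ry)) + (μ.real Rc - μ.real Ry) :=
    lonelyClusterTransfer w hyc x A j hle
  -- on `{y ↔ c}` the loneliness events coincide
  have hF2 : Rc \ D = Ry \ D := by
    ext ω
    simp only [hRc, hRy, hD, mem_sdiff, mem_compl_iff, not_not, mem_setOf_eq]
    constructor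
    · rintro ⟨h, hyc'⟩
      have hyc'' : (openGraph ω).Reachable y c := hyc'
      have heq : (A.filter fun z => ω ∈ openConn y z) = (A.filter fun z => ω ∈ openConn c z) :=
        Finset.filter_congr fun z _ =>
          ⟨fun hz => (hyc''.symm.trans hz : (openGraph ω).Reachable c z),
            fun hz => (hyc''.trans hz : (openGraph ω).Reachable y z)⟩
      rw [heq]
      exact ⟨h, hyc'⟩
    · rintro ⟨h, hyc'⟩
      have hyc'' : (openGraph ω).Reachable y c := hyc'
      have heq : (A.filter fun z => ω ∈ openConn c z) = (A.filter fun z => ω ∈ openConn y z) :=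
        Finset.filter_congr fun z _ =>
          ⟨fun hz => (hyc''.trans hz : (openGraph ω).Reachable y z),
            fun hz => (hyc''.symm.trans hz : (openGraph ω).Reachable c z)⟩
      rw [heq]
      exact ⟨h, hyc'⟩
  -- three-way splits of `Rc` and `Ry`
  have hc1 : μ.real (Rc ∩ D) + μ.real (Rc \ D) = μ.real Rc := measureReal_inter_add_sdiff (hmeas D)
  have hy1 : μ.real (Ry ∩ D) + μ.real (Ry \ D) = μ.real Ry := measureReal_inter_add_sdiff (hmeas D)
  have hc2 : μ.real (Rc ∩ D ∩ X) + μ.real ((Rc ∩ D) \ X) = μ.real (Rc ∩ D) :=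
    measureReal_inter_add_sdiff (hmeas X)
  have hy2 : μ.real (Ry ∩ D ∩ X) + μ.real ((Ry ∩ D) \ X) = μ.real (Ry ∩ D) :=
    measureReal_inter_add_sdiff (hmeas X)
  have e1 : Rc ∩ D ∩ X = D ∩ (Rc ∩ X) := by
    ext ω; simp only [mem_inter_iff]; tauto
  have e4 : Ry ∩ D ∩ X = D ∩ (X ∩ Ry) := by
    ext ω; simp only [mem_inter_iff]; tauto
  rw [e1] at hc2
  rw [e4] at hy2
  rw [hF2] at hc1
  linarith

/-! ### Observer-set form

The same argument with `{t ↔ x}` replaced by an arbitrary event `B` closed under (shrinking `C_s`,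
enlarging `C_t`) — e.g. `B = ⋃_{x ∈ X} {t ↔ x}` — gives the transfer for a SET of observers, and hence the
champion-stability inequality for an observer set `O` containing a vertex no lonelier than `c`. -/

/-- **Lonely-cluster exchange, general type-`(−)` event.**  For `s ≠ t`, `D = {s ↮ t}`, `R_v = {|π(v)| ≤ j}`
and any event `B` closed under shrinking `C_s` and enlarging `C_t`:
`μ(D ∩ (R_t ∩ B)) · μ(D ∩ R_s) ≤ μ(D ∩ R_t) · μ(D ∩ (B ∩ R_s))`.
[cite: VandenbergHaggstromKahn2005, Thm. 1.5 (p. 7) — corollary, derived in this file] -/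
theorem lonelyClusterExchange_typeMinus [Fintype V] (w : Sym2 V → unitInterval) {s t : V} (hst : s ≠ t)
    (A : Finset V) (j : ℕ) {B : Set (BondConfig V)}
    (hB : ∀ ⦃ω ω' : BondConfig V⦄, openEdgeCluster ω' s ⊆ openEdgeCluster ω s →
      openEdgeCluster ω t ⊆ openEdgeCluster ω' t → ω ∈ B → ω' ∈ B) :
    (prodBernoulli w).real ((openConn s t)ᶜ ∩
        ({ω : BondConfig V | (A.filter fun z => ω ∈ openConn t z).card ≤ j} ∩ B)) *
      (prodBernoulli w).real ((openConn s t)ᶜ ∩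
        {ω : BondConfig V | (A.filter fun z => ω ∈ openConn s z).card ≤ j}) ≤
    (prodBernoulli w).real ((openConn s t)ᶜ ∩
        {ω : BondConfig V | (A.filter fun z => ω ∈ openConn t z).card ≤ j}) *
      (prodBernoulli w).real ((openConn s t)ᶜ ∩
        (B ∩ {ω : BondConfig V | (A.filter fun z => ω ∈ openConn s z).card ≤ j})) := by
  have key := twoClusterExchange w hst
    (A₁ := {ω : BondConfig V | (A.filter fun z => ω ∈ openConn t z).card ≤ j})
    (A₂ := (univ : Set (BondConfig V))) (B₁ := B)
    (B₂ := {ω : BondConfig V | (A.filter fun z => ω ∈ openConn s z).card ≤ j})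
    (typePlus_card_le A j s t) (fun _ _ _ _ _ => mem_univ _) hB (typeMinus_card_le A j s t)
  simpa only [univ_inter, inter_univ] using key

/-- **Lonely-cluster transfer, general type-`(−)` event.**  If `s ≠ t`, `μ(R_s) ≤ μ(R_t)` and `B` is closed
under (shrinking `C_s`, enlarging `C_t`), then `μ(D ∩ R_t ∩ B) ≤ μ(D ∩ B ∩ R_s) + (μ(R_t) − μ(R_s))`.
[cite: VandenbergHaggstromKahn2005, Thm. 1.5 (p. 7) — corollary, derived in this file] -/
theorem lonelyClusterTransfer_typeMinus [Fintype V] (w : Sym2 V → unitInterval) {s t : V} (hst : s ≠ t)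
    (A : Finset V) (j : ℕ) {B : Set (BondConfig V)}
    (hB : ∀ ⦃ω ω' : BondConfig V⦄, openEdgeCluster ω' s ⊆ openEdgeCluster ω s →
      openEdgeCluster ω t ⊆ openEdgeCluster ω' t → ω ∈ B → ω' ∈ B)
    (hle : (prodBernoulli w).real {ω : BondConfig V | (A.filter fun z => ω ∈ openConn s z).card ≤ j} ≤
      (prodBernoulli w).real {ω : BondConfig V | (A.filter fun z => ω ∈ openConn t z).card ≤ j}) :
    (prodBernoulli w).real ((openConn s t)ᶜ ∩
        ({ω : BondConfig V | (A.filter fun z => ω ∈ openConn t z).card ≤ j} ∩ B)) ≤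
      (prodBernoulli w).real ((openConn s t)ᶜ ∩
        (B ∩ {ω : BondConfig V | (A.filter fun z => ω ∈ openConn s z).card ≤ j})) +
      ((prodBernoulli w).real {ω : BondConfig V | (A.filter fun z => ω ∈ openConn t z).card ≤ j} -
        (prodBernoulli w).real {ω : BondConfig V | (A.filter fun z => ω ∈ openConn s z).card ≤ j}) := by
  set μ := prodBernoulli w with hμ
  set Rt : Set (BondConfig V) := {ω | (A.filter fun z => ω ∈ openConn t z).card ≤ j} with hRt
  set Rs : Set (BondConfig V) := {ω | (A.filter fun z => ω ∈ openConn s z).card ≤ j} with hRs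
  set D : Set (BondConfig V) := (openConn s t)ᶜ with hD
  have hmeas : ∀ S : Set (BondConfig V), MeasurableSet S := fun S => (Set.toFinite S).measurableSet
  have key : μ.real (D ∩ (Rt ∩ B)) * μ.real (D ∩ Rs) ≤ μ.real (D ∩ Rt) * μ.real (D ∩ (B ∩ Rs)) :=
    lonelyClusterExchange_typeMinus w hst A j hB
  have hF2 : Rt \ D = Rs \ D := by
    ext ω
    simp only [hRt, hRs, hD, mem_sdiff, mem_compl_iff, not_not, mem_setOf_eq]
    constructor
    · rintro ⟨h, hst'⟩
      have hst'' : (openGraph ω).Reachable s t := hst'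
      have heq : (A.filter fun z => ω ∈ openConn s z) = (A.filter fun z => ω ∈ openConn t z) :=
        Finset.filter_congr fun z _ =>
          ⟨fun hz => (hst''.symm.trans hz : (openGraph ω).Reachable t z),
            fun hz => (hst''.trans hz : (openGraph ω).Reachable s z)⟩
      rw [heq]
      exact ⟨h, hst'⟩
    · rintro ⟨h, hst'⟩
      have hst'' : (openGraph ω).Reachable s t := hst'
      have heq : (A.filter fun z => ω ∈ openConn t z) = (A.filter fun z => ω ∈ openConn s z) :=
        Finset.filter_congr fun z _ =>
          ⟨fun hz => (hst''.trans hz : (openGraph ω).Reachable s z),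
            fun hz => (hst''.symm.trans hz : (openGraph ω).Reachable t z)⟩
      rw [heq]
      exact ⟨h, hst'⟩
  have hsplit_t : μ.real (Rt ∩ D) + μ.real (Rt \ D) = μ.real Rt := measureReal_inter_add_sdiff (hmeas D)
  have hsplit_s : μ.real (Rs ∩ D) + μ.real (Rs \ D) = μ.real Rs := measureReal_inter_add_sdiff (hmeas D)
  have h3 : μ.real (D ∩ Rt) = μ.real Rt - μ.real (Rt \ D) := by rw [inter_comm]; linarith
  have h2 : μ.real (D ∩ Rs) = μ.real Rs - μ.real (Rs \ D) := by rw [inter_comm]; linarith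
  have hm4 : μ.real (D ∩ (B ∩ Rs)) ≤ μ.real (D ∩ Rs) :=
    measureReal_mono (inter_subset_inter_right _ inter_subset_right)
  have hΔ : 0 ≤ μ.real Rt - μ.real Rs := by linarith
  by_cases h0 : μ.real (D ∩ Rs) = 0
  · have hm4' : μ.real (D ∩ (B ∩ Rs)) = 0 := le_antisymm (h0 ▸ hm4) measureReal_nonneg
    have hm1 : μ.real (D ∩ (Rt ∩ B)) ≤ μ.real (D ∩ Rt) :=
      measureReal_mono (inter_subset_inter_right _ inter_subset_left)
    rw [hm4']
    rw [h3, h2, hF2] at *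
    linarith
  · have hpos : 0 < μ.real (D ∩ Rs) := lt_of_le_of_ne measureReal_nonneg (Ne.symm h0)
    have h' : μ.real (D ∩ (Rt ∩ B)) * μ.real (D ∩ Rs) ≤
        μ.real (D ∩ Rs) * (μ.real (D ∩ (B ∩ Rs)) + (μ.real Rt - μ.real Rs)) := by
      have h3' : μ.real (D ∩ Rt) = μ.real (D ∩ Rs) + (μ.real Rt - μ.real Rs) := by
        rw [h3, h2, hF2]; ring
      rw [h3'] at key
      nlinarith [measureReal_nonneg (μ := μ) (s := D ∩ (B ∩ Rs))]
    rw [mul_comm] at h'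
    exact le_of_mul_le_mul_left h' hpos

/-- **Observer-set transfer.**  For a finite observer set `O`, a vertex `y ∈ O` and a vertex `c` with
`μ(R_y) ≤ μ(R_c)`:  `μ(c ↮ O, 1 ≤ |π(O)| ≤ j) ≤ μ(c ↮ O, |π(c)| ≤ j)`, where `{c ↮ O} = ⋂_{x∈O} {c ↮ x}` and
`π(O) = A.filter (fun z => ∃ x ∈ O, x ↔ z)`.  (Champion stability for gluing the observer to a whole set
containing a vertex no lonelier than `c`, e.g. a relay.)
[cite: VandenbergHaggstromKahn2005, Thm. 1.5 (p. 7) — corollary, derived in this file] -/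
theorem observerSet_le_of_lonelier [Fintype V] (w : Sym2 V → unitInterval) (A O : Finset V)
    (y c : V) (hy : y ∈ O) (j : ℕ)
    (hle : (prodBernoulli w).real {ω : BondConfig V | (A.filter fun z => ω ∈ openConn y z).card ≤ j} ≤
      (prodBernoulli w).real {ω : BondConfig V | (A.filter fun z => ω ∈ openConn c z).card ≤ j}) :
    (prodBernoulli w).real {ω : BondConfig V | (∀ x ∈ O, ω ∉ openConn c x) ∧
        1 ≤ (A.filter fun z => ∃ x ∈ O, ω ∈ openConn x z).card ∧
        (A.filter fun z => ∃ x ∈ O, ω ∈ openConn x z).card ≤ j} ≤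
      (prodBernoulli w).real {ω : BondConfig V | (∀ x ∈ O, ω ∉ openConn c x) ∧
        (A.filter fun z => ω ∈ openConn c z).card ≤ j} := by
  set μ := prodBernoulli w with hμ
  set Rc : Set (BondConfig V) := {ω | (A.filter fun z => ω ∈ openConn c z).card ≤ j} with hRc
  set Ry : Set (BondConfig V) := {ω | (A.filter fun z => ω ∈ openConn y z).card ≤ j} with hRy
  set D : Set (BondConfig V) := (openConn y c)ᶜ with hD
  -- `X = ⋃_{x ∈ O, x ≠ y} {c ↔ x}`, of type `(−)` for the pair `(y, c)`
  set X : Set (BondConfig V) := ⋃ x ∈ O.erase y, (openConn c x : Set (BondConfig V)) with hX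
  have hXtype : ∀ ⦃ω ω' : BondConfig V⦄, openEdgeCluster ω' y ⊆ openEdgeCluster ω y →
      openEdgeCluster ω c ⊆ openEdgeCluster ω' c → ω ∈ X → ω' ∈ X := by
    intro ω ω' h1 h2 hω
    rw [hX, mem_iUnion₂] at hω ⊢
    obtain ⟨x, hx, hωx⟩ := hω
    exact ⟨x, hx, typeMinus_openConn y c x h1 h2 hωx⟩
  have hmeas : ∀ S : Set (BondConfig V), MeasurableSet S := fun S => (Set.toFinite S).measurableSet
  by_cases hyc : y = c
  · subst hyc
    have hempty : {ω : BondConfig V | (∀ x ∈ O, ω ∉ openConn y x) ∧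
        1 ≤ (A.filter fun z => ∃ x ∈ O, ω ∈ openConn x z).card ∧
        (A.filter fun z => ∃ x ∈ O, ω ∈ openConn x z).card ≤ j} = ∅ := by
      ext ω
      simp only [mem_setOf_eq, mem_empty_iff_false, iff_false, not_and]
      intro h
      exact absurd (SimpleGraph.Reachable.refl y : (openGraph ω).Reachable y y) (h y hy)
    rw [hempty, measureReal_empty]
    exact measureReal_nonneg
  have hsymm : (openConn y c : Set (BondConfig V)) = openConn c y :=
    Set.ext fun _ => ⟨SimpleGraph.Reachable.symm, SimpleGraph.Reachable.symm⟩
  -- `{c ↮ O} = D ∩ Xᶜ`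
  have hG : ∀ ω : BondConfig V, (∀ x ∈ O, ω ∉ openConn c x) ↔ (ω ∈ D ∧ ω ∉ X) := by
    intro ω
    rw [hD, hX, hsymm, mem_compl_iff, mem_iUnion₂]
    constructor
    · intro h
      refine ⟨h y hy, ?_⟩
      rintro ⟨x, hx, hωx⟩
      exact h x (Finset.mem_of_mem_erase hx) hωx
    · rintro ⟨h1, h2⟩ x hx
      by_cases hxy : x = y
      · subst hxy; exact h1
      · exact fun hωx => h2 ⟨x, Finset.mem_erase.2 ⟨hxy, hx⟩, hωx⟩
  have hR : {ω : BondConfig V | (∀ x ∈ O, ω ∉ openConn c x) ∧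
      (A.filter fun z => ω ∈ openConn c z).card ≤ j} = (Rc ∩ D) \ X := by
    ext ω
    simp only [mem_setOf_eq, mem_sdiff, mem_inter_iff, hG ω, hRc]
    tauto
  have hL : {ω : BondConfig V | (∀ x ∈ O, ω ∉ openConn c x) ∧
      1 ≤ (A.filter fun z => ∃ x ∈ O, ω ∈ openConn x z).card ∧
      (A.filter fun z => ∃ x ∈ O, ω ∈ openConn x z).card ≤ j} ⊆ (Ry ∩ D) \ X := by
    intro ω hω
    obtain ⟨hG', -, hU⟩ := hω
    obtain ⟨hD', hX'⟩ := (hG ω).1 hG'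
    simp only [hRy, mem_sdiff, mem_inter_iff, mem_setOf_eq]
    refine ⟨⟨le_trans (Finset.card_le_card ?_) hU, hD'⟩, hX'⟩
    intro z hz
    rw [Finset.mem_filter] at hz ⊢
    exact ⟨hz.1, y, hy, hz.2⟩
  rw [hR]
  refine le_trans (measureReal_mono hL) ?_
  have hT : μ.real (D ∩ (Rc ∩ X)) ≤ μ.real (D ∩ (X ∩ Ry)) + (μ.real Rc - μ.real Ry) :=
    lonelyClusterTransfer_typeMinus w hyc A j hXtype hle
  have hF2 : Rc \ D = Ry \ D := by
    ext ω
    simp only [hRc, hRy, hD, mem_sdiff, mem_compl_iff, not_not, mem_setOf_eq]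
    constructor
    · rintro ⟨h, hyc'⟩
      have hyc'' : (openGraph ω).Reachable y c := hyc'
      have heq : (A.filter fun z => ω ∈ openConn y z) = (A.filter fun z => ω ∈ openConn c z) :=
        Finset.filter_congr fun z _ =>
          ⟨fun hz => (hyc''.symm.trans hz : (openGraph ω).Reachable c z),
            fun hz => (hyc''.trans hz : (openGraph ω).Reachable y z)⟩
      rw [heq]
      exact ⟨h, hyc'⟩
    · rintro ⟨h, hyc'⟩
      have hyc'' : (openGraph ω).Reachable y c := hyc'
      have heq : (A.filter fun z => ω ∈ openConn c z) = (A.filter fun z => ω ∈ openConn y z) :=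
        Finset.filter_congr fun z _ =>
          ⟨fun hz => (hyc''.trans hz : (openGraph ω).Reachable y z),
            fun hz => (hyc''.symm.trans hz : (openGraph ω).Reachable c z)⟩
      rw [heq]
      exact ⟨h, hyc'⟩
  have hc1 : μ.real (Rc ∩ D) + μ.real (Rc \ D) = μ.real Rc := measureReal_inter_add_sdiff (hmeas D)
  have hy1 : μ.real (Ry ∩ D) + μ.real (Ry \ D) = μ.real Ry := measureReal_inter_add_sdiff (hmeas D)
  have hc2 : μ.real (Rc ∩ D ∩ X) + μ.real ((Rc ∩ D) \ X) = μ.real (Rc ∩ D) :=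
    measureReal_inter_add_sdiff (hmeas X)
  have hy2 : μ.real (Ry ∩ D ∩ X) + μ.real ((Ry ∩ D) \ X) = μ.real (Ry ∩ D) :=
    measureReal_inter_add_sdiff (hmeas X)
  have e1 : Rc ∩ D ∩ X = D ∩ (Rc ∩ X) := by
    ext ω; simp only [mem_inter_iff]; tauto
  have e4 : Ry ∩ D ∩ X = D ∩ (X ∩ Ry) := by
    ext ω; simp only [mem_inter_iff]; tauto
  rw [e1] at hc2
  rw [e4] at hy2
  rw [hF2] at hc1
  linarith

/-! ### The mirror-odds exchange

For `s ≠ t`, `D = {s ↮ t}`, a "world" `W₊` of type `(+)` (closed under enlarging `C_s`, shrinking `C_t`), a world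
`W₋` of type `(−)`, and marker events `E_s` of type `(+)`, `E_t` of type `(−)` with `D ∩ E_s ∩ E_t = ∅`:

  `μ(D ∩ W₊ ∩ E_t) · μ(D ∩ W₋ ∩ E_s) ≤ μ(D ∩ W₋ ∩ E_sᶜ) · μ(D ∩ W₊ ∩ E_tᶜ)`,

i.e. `odds(E_t | D ∩ W₊) · odds(E_s | D ∩ W₋) ≤ 1`.  By BHK Thm. 1.5, opposite-type events are negatively correlated
given `D`, so `odds(E_t | D ∩ W₊) ≤ odds(E_t | D)` and `odds(E_s | D ∩ W₋) ≤ odds(E_s | D)`; and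
`odds(E_t | D) · odds(E_s | D) ≤ 1` because `E_s`, `E_t` are incompatible on `D` (`μ(D ∩ E_t) ≤ μ(D ∩ E_sᶜ)`,
`μ(D ∩ E_s) ≤ μ(D ∩ E_tᶜ)`).  The instance `W₊ = R_t ∩ R_sᶜ`, `W₋ = R_s ∩ R_tᶜ`, `E_s = {s ↔ b}`, `E_t = {t ↔ b}`
("in each world the marker joins the LONELY cluster" on the left, "does not join it" on the right) is the
unguarded form of the exchange (SP)/(LSL-X) of the hull-port line of `stmt-CriticalPhenomena-4575`; the guarded
form (every factor intersected with `{z ∉ C_s ∪ C_t}`) is not in print and is not derived here. -/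

/-- **Mirror-odds exchange (general form).**  Let `s ≠ t`, `D = {s ↮ t}`; let `W₊, E_s` be events closed under
(enlarging `C_s`, shrinking `C_t`) and `W₋, E_t` events closed under (shrinking `C_s`, enlarging `C_t`), with
`E_s ∩ E_t ∩ D = ∅`.  Then
`μ(D ∩ (W₊ ∩ E_t)) · μ(D ∩ (W₋ ∩ E_s)) ≤ μ(D ∩ (W₋ ∩ E_sᶜ)) · μ(D ∩ (W₊ ∩ E_tᶜ))`.
[cite: VandenbergHaggstromKahn2005, Thm. 1.5 (p. 7) — corollary, derived in this file] -/
theorem mirrorOdds_exchange [Fintype V] (w : Sym2 V → unitInterval) {s t : V} (hst : s ≠ t)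
    {Wp Wm Es Et : Set (BondConfig V)}
    (hWp : ∀ ⦃ω ω' : BondConfig V⦄, openEdgeCluster ω s ⊆ openEdgeCluster ω' s →
      openEdgeCluster ω' t ⊆ openEdgeCluster ω t → ω ∈ Wp → ω' ∈ Wp)
    (hWm : ∀ ⦃ω ω' : BondConfig V⦄, openEdgeCluster ω' s ⊆ openEdgeCluster ω s →
      openEdgeCluster ω t ⊆ openEdgeCluster ω' t → ω ∈ Wm → ω' ∈ Wm)
    (hEs : ∀ ⦃ω ω' : BondConfig V⦄, openEdgeCluster ω s ⊆ openEdgeCluster ω' s →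
      openEdgeCluster ω' t ⊆ openEdgeCluster ω t → ω ∈ Es → ω' ∈ Es)
    (hEt : ∀ ⦃ω ω' : BondConfig V⦄, openEdgeCluster ω' s ⊆ openEdgeCluster ω s →
      openEdgeCluster ω t ⊆ openEdgeCluster ω' t → ω ∈ Et → ω' ∈ Et)
    (hdisj : ∀ ω : BondConfig V, ω ∈ (openConn s t : Set (BondConfig V))ᶜ → ω ∈ Es → ω ∈ Et → False) :
    (prodBernoulli w).real ((openConn s t)ᶜ ∩ (Wp ∩ Et)) *
        (prodBernoulli w).real ((openConn s t)ᶜ ∩ (Wm ∩ Es)) ≤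
      (prodBernoulli w).real ((openConn s t)ᶜ ∩ (Wm ∩ Esᶜ)) *
        (prodBernoulli w).real ((openConn s t)ᶜ ∩ (Wp ∩ Etᶜ)) := by
  set μ := prodBernoulli w with hμ
  set D : Set (BondConfig V) := (openConn s t)ᶜ with hD
  -- one application of Thm. 1.5 per world
  have h1 : μ.real (D ∩ (Wp ∩ Et)) * μ.real (D ∩ (Etᶜ ∩ univ)) ≤
      μ.real (D ∩ (Wp ∩ Etᶜ)) * μ.real (D ∩ (Et ∩ univ)) :=
    twoClusterExchange w hst (A₁ := Wp) (B₁ := Et) (A₂ := Etᶜ) (B₂ := univ)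
      hWp (fun _ _ hs ht h h' => h (hEt hs ht h')) hEt (fun _ _ _ _ _ => mem_univ _)
  have h2 : μ.real (D ∩ (Es ∩ Wm)) * μ.real (D ∩ (univ ∩ Esᶜ)) ≤
      μ.real (D ∩ (Es ∩ univ)) * μ.real (D ∩ (Wm ∩ Esᶜ)) :=
    twoClusterExchange w hst (A₁ := Es) (B₁ := Wm) (A₂ := univ) (B₂ := Esᶜ)
      hEs (fun _ _ _ _ _ => mem_univ _) hWm (fun _ _ hs ht h h' => h (hEs hs ht h'))
  simp only [inter_univ, univ_inter] at h1 h2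
  rw [show D ∩ (Es ∩ Wm) = D ∩ (Wm ∩ Es) by rw [inter_comm Es Wm]] at h2
  -- incompatibility of the two marker events on `D`
  have h3 : μ.real (D ∩ Et) ≤ μ.real (D ∩ Esᶜ) :=
    measureReal_mono fun ω hω => ⟨hω.1, fun hs => hdisj ω hω.1 hs hω.2⟩
  have h4 : μ.real (D ∩ Es) ≤ μ.real (D ∩ Etᶜ) :=
    measureReal_mono fun ω hω => ⟨hω.1, fun ht => hdisj ω hω.1 hω.2 ht⟩
  have ha : μ.real (D ∩ (Wp ∩ Et)) ≤ μ.real (D ∩ Et) :=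
    measureReal_mono (inter_subset_inter_right _ inter_subset_right)
  have hb : μ.real (D ∩ (Wm ∩ Es)) ≤ μ.real (D ∩ Es) :=
    measureReal_mono (inter_subset_inter_right _ inter_subset_right)
  have h0a : 0 ≤ μ.real (D ∩ (Wp ∩ Et)) := measureReal_nonneg
  have h0b : 0 ≤ μ.real (D ∩ (Wm ∩ Es)) := measureReal_nonneg
  have h0c : 0 ≤ μ.real (D ∩ (Wm ∩ Esᶜ)) := measureReal_nonneg
  have h0d : 0 ≤ μ.real (D ∩ (Wp ∩ Etᶜ)) := measureReal_nonneg
  have h0e : 0 ≤ μ.real (D ∩ Etᶜ) := measureReal_nonneg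
  have h0g : 0 ≤ μ.real (D ∩ Esᶜ) := measureReal_nonneg
  have h0f : 0 ≤ μ.real (D ∩ Et) := measureReal_nonneg
  have h0k : 0 ≤ μ.real (D ∩ Es) := measureReal_nonneg
  by_cases he : μ.real (D ∩ Etᶜ) = 0
  · -- then `μ(D ∩ Es) = 0`, so the second left factor vanishes
    have hb0 : μ.real (D ∩ (Wm ∩ Es)) = 0 := le_antisymm (by linarith) h0b
    rw [hb0, mul_zero]
    exact mul_nonneg h0c h0d
  by_cases hg : μ.real (D ∩ Esᶜ) = 0
  · have ha0 : μ.real (D ∩ (Wp ∩ Et)) = 0 := le_antisymm (by linarith) h0a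
    rw [ha0, zero_mul]
    exact mul_nonneg h0c h0d
  have hepos : 0 < μ.real (D ∩ Etᶜ) := lt_of_le_of_ne h0e (Ne.symm he)
  have hgpos : 0 < μ.real (D ∩ Esᶜ) := lt_of_le_of_ne h0g (Ne.symm hg)
  have key : μ.real (D ∩ (Wp ∩ Et)) * μ.real (D ∩ (Wm ∩ Es)) * (μ.real (D ∩ Etᶜ) * μ.real (D ∩ Esᶜ)) ≤
      μ.real (D ∩ (Wm ∩ Esᶜ)) * μ.real (D ∩ (Wp ∩ Etᶜ)) * (μ.real (D ∩ Etᶜ) * μ.real (D ∩ Esᶜ)) :=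
    calc μ.real (D ∩ (Wp ∩ Et)) * μ.real (D ∩ (Wm ∩ Es)) * (μ.real (D ∩ Etᶜ) * μ.real (D ∩ Esᶜ))
        = (μ.real (D ∩ (Wp ∩ Et)) * μ.real (D ∩ Etᶜ)) * (μ.real (D ∩ (Wm ∩ Es)) * μ.real (D ∩ Esᶜ)) := by
          ring
      _ ≤ (μ.real (D ∩ (Wp ∩ Etᶜ)) * μ.real (D ∩ Et)) * (μ.real (D ∩ Es) * μ.real (D ∩ (Wm ∩ Esᶜ))) :=
          mul_le_mul h1 h2 (mul_nonneg h0b h0g) (mul_nonneg h0d h0f)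
      _ = μ.real (D ∩ (Wm ∩ Esᶜ)) * μ.real (D ∩ (Wp ∩ Etᶜ)) * (μ.real (D ∩ Et) * μ.real (D ∩ Es)) := by
          ring
      _ ≤ μ.real (D ∩ (Wm ∩ Esᶜ)) * μ.real (D ∩ (Wp ∩ Etᶜ)) * (μ.real (D ∩ Esᶜ) * μ.real (D ∩ Etᶜ)) :=
          mul_le_mul_of_nonneg_left (mul_le_mul h3 h4 h0k h0g) (mul_nonneg h0c h0d)
      _ = μ.real (D ∩ (Wm ∩ Esᶜ)) * μ.real (D ∩ (Wp ∩ Etᶜ)) * (μ.real (D ∩ Etᶜ) * μ.real (D ∩ Esᶜ)) := by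
          ring
  exact le_of_mul_le_mul_right key (mul_pos hepos hgpos)


/-- **Mirror-odds exchange for the lonely cluster and a marker** (unguarded (SP)/(LSL-X)).  For `s ≠ t`, a
vertex `b`, a finite `A` and a level `j`, with `D = {s ↮ t}`, `R_v = {|π(v)| ≤ j}`:
`μ(D ∩ ((R_t ∩ R_sᶜ) ∩ {t ↔ b})) · μ(D ∩ ((R_s ∩ R_tᶜ) ∩ {s ↔ b})) ≤ μ(D ∩ ((R_s ∩ R_tᶜ) ∩ {s ↮ b})) · μ(D ∩ ((R_t ∩ R_sᶜ) ∩ {t ↮ b}))`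
— in the world where `t` is lonely and `s` is not, and in the mirror world, the product of the odds that the
marker `b` joins the lonely cluster is at most `1`.  (The guarded form, with every factor intersected with
`{z ∉ C_s ∪ C_t}`, is the open exchange (SP)/(LSL-X) of `stmt-CriticalPhenomena-4575`; it is not derived here.)
[cite: VandenbergHaggstromKahn2005, Thm. 1.5 (p. 7) — corollary, derived in this file] -/
theorem mirrorOdds_lightCluster_marker [Fintype V] (w : Sym2 V → unitInterval) {s t : V} (hst : s ≠ t)
    (b : V) (A : Finset V) (j : ℕ) :
    (prodBernoulli w).real ((openConn s t)ᶜ ∩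
        (({ω : BondConfig V | (A.filter fun z => ω ∈ openConn t z).card ≤ j} ∩
            {ω : BondConfig V | (A.filter fun z => ω ∈ openConn s z).card ≤ j}ᶜ) ∩ openConn t b)) *
      (prodBernoulli w).real ((openConn s t)ᶜ ∩
        (({ω : BondConfig V | (A.filter fun z => ω ∈ openConn s z).card ≤ j} ∩
            {ω : BondConfig V | (A.filter fun z => ω ∈ openConn t z).card ≤ j}ᶜ) ∩ openConn s b)) ≤
    (prodBernoulli w).real ((openConn s t)ᶜ ∩
        (({ω : BondConfig V | (A.filter fun z => ω ∈ openConn s z).card ≤ j} ∩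
            {ω : BondConfig V | (A.filter fun z => ω ∈ openConn t z).card ≤ j}ᶜ) ∩ (openConn s b)ᶜ)) *
      (prodBernoulli w).real ((openConn s t)ᶜ ∩
        (({ω : BondConfig V | (A.filter fun z => ω ∈ openConn t z).card ≤ j} ∩
            {ω : BondConfig V | (A.filter fun z => ω ∈ openConn s z).card ≤ j}ᶜ) ∩ (openConn t b)ᶜ)) := by
  refine mirrorOdds_exchange w hst ?_ ?_ (typePlus_openConn s t b) (typeMinus_openConn s t b) ?_
  · intro ω ω' h1 h2 hω
    exact ⟨typePlus_card_le A j s t h1 h2 hω.1, fun h' => hω.2 (typeMinus_card_le A j s t h1 h2 h')⟩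
  · intro ω ω' h1 h2 hω
    exact ⟨typeMinus_card_le A j s t h1 h2 hω.1, fun h' => hω.2 (typePlus_card_le A j s t h1 h2 h')⟩
  · intro ω hD hs ht
    exact hD ((hs : (openGraph ω).Reachable s b).trans (ht : (openGraph ω).Reachable t b).symm)

end Literature.Probability.Percolation


end
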